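import Summits.BirchSwinnertonDyer.Rank1Residual.Additive.DivisionPolynomialInfiniteHeight
import Summits.BirchSwinnertonDyer.BirchSwinnertonDyer.Theorems.Rank1ResidualIntModelReduction
import Literature.NumberTheory.EllipticCurves.Rank1Residual.Predicates
import Literature.NumberTheory.EllipticCurves.CuspidalReductionInfiniteHeightProofs
import Literature.NumberTheory.EllipticCurves.OrdinaryPrimesProofs
import Literature.NumberTheory.EllipticCurves.FormalGroupChart
import Literature.NumberTheory.EllipticCurves.VariableChangePoints
import HarnessLib

/-!
# LEMMA A AT POINTS: at an ADDITIVE prime `p` of a globally minimal `W/ℚ`, over EVERY valued field `F`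
# (`p ≠ 0` in `F`), `|x(pP)|·|p|² = |x(P)|` — i.e. `|z(pP)| = |p|·|z(P)|` — and `pP ≠ O` on the kernel of
# reduction `E₁(F)`; hence `E₁(F)` is TORSION-FREE however ramified `F` is (no completeness)
# (cell `b2b-bsdres`, team n1011, seat p05 GEN 13, ROW T-O6-LOGA F2b; O6 lane = cc-typer / o6-r1 / o6-r2;
#  theorems only)

HONEST FRAMING (cell `b2b-bsdres`, run/shared/lean/b2b/bsd-rank1-residual/, verbatim in every file): the
goal of the cell is to DELETE the COMBINATION-SHAPED residual classes of the Birch–Swinnerton-Dyer formula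
for ALL analytic-rank `≤ 1` elliptic curves over `ℚ` — "full BSD formula for every rank `≤ 1` curve in
class `C`" assembled STRICTLY from published theorems — so that the rank-`≤ 1` remainder becomes exactly
the CONSTRUCTION-SHAPED classes, which are TYPED (missing-input `Prop`s), NOT attempted. This is not
"finishing BSD". Lane CLASS-CLOSURE / teams o5–o6 (O6 OPEN) and team n1011 (N10/N11): research routes;
census output is EVIDENCE, never a Literature fact; nothing is booked; no mark of `RESIDUAL-MAP.md`
moves. This file: THEOREMS ONLY (no definition, no named fact, no `@[conjecture]` node, no `sorry`; net
named-fact debt `0`); nothing about any particular curve is asserted.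

## What is proved

For `W/ℚ` elliptic and globally minimal with `Addv W p` (additive reduction at the prime `p`), its integer
model `W_ℤ = integralModelInt W`, and ANY field `F` with a valuation `|·| : F → ℝ≥0`
(`W_ℤ ⊗ F := W_ℤ.map (ℤ → F)`; for a `ℚ`-algebra `F` this is `W ⊗ F`):

* §1 **`exists_rst_map_eq_zero_of_addv`** — a CUSP-NORMAL integer model: integers `r, s, t` with
  `(1, r, s, t) • W_ℤ ≡ (y² = x³) (mod p)` (all `aᵢ ≡ 0`): the reduction of `W_ℤ` is cuspidal (`p ∣ Δ_min`,
  `p ∣ c₄(W_ℤ)`: `Additive.dvd_c₄_of_addv` pattern), a cuspidal cubic over `𝔽_p` is `y² = x³` up to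
  `(1, r̄, s̄, t̄)` (tree `exists_variableChange_eq_zero_of_cuspidal`, every `p`), and `r̄, s̄, t̄` lift to `ℤ`.
* §2 **`val_x_zsmul_prime_of_addv`**: if `p ≠ 0` in `F`, then for every affine point `P = (x, y)` of
  `W_ℤ ⊗ F` with `|x| > 1` (i.e. `P ∈ E₁(F)`): `pP ≠ O`, `|x(pP)| > 1` and **`|x(pP)| · |p|² = |x|`** —
  transport along the `F`-isomorphism `(1, r, s, t)` (`VariableChange.pointEquiv`; `x ↦ x - r` preserves
  `|x| > 1`) to the cusp-normal model, where `p² ∣ ΨSq_p` (F2a `sq_dvd_coeff_ΨSq_of_map_eq_zero`) and the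
  division-polynomial estimate F2a `val_x_zsmul_prime_of_val_coeff_le` applies;
  **`zsmul_ne_zero_of_addv_of_one_lt_val`**: if moreover `|p| < 1` then `nP ≠ O` for every `n ≠ 0` —
  **`E₁(F)` is TORSION-FREE** (the `p`-part by iteration, the prime-to-`p` part by the tree's
  `val_le_one_of_zsmul_eq_zero`, an integer prime to `p` being a `|·|`-unit);
  **`val_zCoord_zsmul_prime_of_addv`**: in the chart currency of `FormalGroupChart` (`z = -x/y`,
  `|x|·|z|² = 1` on `E₁`), `|z(pP)| = |p| · |z(P)|` for every `P ∈ E₁(F)` — `[p]` multiplies the local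
  parameter by EXACTLY `|p|` at EVERY level (not only below the level `|p|`, where the tree's
  `FormalGroupDivision` / `val_zCoord_nsmul_eq` already give it for any reduction type).

This is the memo's COROLLARY (b) of LEMMA A (o6-r1 GEN 16 §1 / `cells/o5o6/TARGETS.md` (G16-1): "for EVERY
finite `K/ℚ_p`, wild included, `W₁^ℚ(K)` is torsion-free") in the kernel, for ALL valued fields at once and
with no completeness; the power-series form of LEMMA A itself (`log_{W ⊗ ℚ_p} ∈ ℤ_p⟦X⟧`, every `p`) is
`O6/IntegralLogAdditiveHolds.lean` (F1, `O6.integralLogAdditive_holds`). What is NOT here: corollary (a)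
`log_ω : E₁(K) ⥲ 𝔪_K` as a map on `K`-points for COMPLETE `K ⊇ ℚ_p` and (c)/(d) the index
`[𝓜_K : 𝔪_K] = p^{i_K}`, `exp* H¹_{/f} = 𝓜_K^⊥` — (a) is a sequel on top of the x1b lane's local series
(`Additive/PadicBallSeriesEval`, `FormalGroupBallPoints*`, `PadicBallLog`: evaluation of `ℤ_p`-series at
points of `𝔪_K`, `Λ = log_E ∘ z` additive on `E₁(K)`), combined with F1's integrality of `log` AND `exp`;
(d) needs Bloch–Kato's `exp*` (no tree vocabulary). The present file is the completeness-free part.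

References: J. H. Silverman, *The Arithmetic of Elliptic Curves*, GTM 106 (2009), III.1 (changes of
variables), Prop. III.2.5, Exercise 3.7 (d), Prop. VII.2.2, VII.3.1, VII.5 Prop. 5.1 (c) [SilvermanAEC2009];
M. Kosters, R. Pannekoek, arXiv:1703.07888 Thm. 1 / Thm. 3 (the structure of `E₁(K)` for unramified /
mildly ramified `K`; the ramified case left open, p. 8) — prose cite; o6-r1 GEN 16 memo
`HOME/b2b-bsdres-o6-r1/gen16/O6-GEN16.md` §1.
-/

noncomputable section

open scoped Classical NNReal

open Polynomial WeierstrassCurve Literature.NumberTheory.EllipticCurves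
  Literature.NumberTheory.EllipticCurves.Rank1Residual
  Summit.BirchSwinnertonDyer.BirchSwinnertonDyer.Rank1Residual.IntModel

namespace Summit.BirchSwinnertonDyer.Rank1Residual.Additive

/-! ## §1 A cusp-normal integer model at an additive prime -/

section CuspNormal

variable (W : WeierstrassCurve ℚ) [W.IsElliptic] [W.IsGloballyMinimal] (p : ℕ) [hp : Fact p.Prime]

/-- **Cusp-normal integer model at an additive prime.** For the globally minimal `W/ℚ` with
`Addv W p` there are INTEGERS `r, s, t` such that the model `(1, r, s, t) • W_ℤ` reduces mod `p` to
`y² = x³` (all `aᵢ ≡ 0 (mod p)`): the reduction of `W_ℤ` is cuspidal (`p ∣ Δ_min`, `p ∣ c₄`), a cuspidal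
cubic over `𝔽_p` is `y² = x³` up to `(1, r̄, s̄, t̄)` (`exists_variableChange_eq_zero_of_cuspidal`), and
`r̄, s̄, t̄` lift to `ℤ`. [cite: SilvermanAEC2009, VII.5 Prop. 5.1 (c) and Prop. III.2.5] -/
theorem exists_rst_map_eq_zero_of_addv (hadd : Addv W p) :
    ∃ r s t : ℤ, ((⟨1, r, s, t⟩ : VariableChange ℤ) • integralModelInt W).map (Int.castRingHom (ZMod p)) =
      ({ a₁ := 0, a₂ := 0, a₃ := 0, a₄ := 0, a₆ := 0 } : WeierstrassCurve (ZMod p)) := by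
  set E := (integralModelInt W).map (Int.castRingHom (ZMod p)) with hE
  have hΔ : (p : ℤ) ∣ (integralModelInt W).Δ := by
    by_contra h
    exact hadd.1 (hasGoodReductionAtPrime_of_not_dvd W p h)
  have hc₄ : (p : ℤ) ∣ (integralModelInt W).c₄ := by
    by_contra h
    exact hadd.2 (hasMultiplicativeReductionAtPrime_of_intModel (W := W) rfl p hΔ h)
  have hEc : E.c₄ = 0 := by
    rw [hE, map_c₄, eq_intCast, ZMod.intCast_zmod_eq_zero_iff_dvd]; exact hc₄
  have hEΔ : E.Δ = 0 := by
    rw [hE, map_Δ, eq_intCast, ZMod.intCast_zmod_eq_zero_iff_dvd]; exact hΔ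
  obtain ⟨C, hCu, hCE⟩ := E.exists_variableChange_eq_zero_of_cuspidal hEc hEΔ
  obtain ⟨r, hr⟩ := ZMod.intCast_surjective C.r
  obtain ⟨s, hs⟩ := ZMod.intCast_surjective C.s
  obtain ⟨t, ht⟩ := ZMod.intCast_surjective C.t
  refine ⟨r, s, t, ?_⟩
  have hC : (⟨1, r, s, t⟩ : VariableChange ℤ).map (Int.castRingHom (ZMod p)) = C := by
    ext
    · simp [VariableChange.map, hCu]
    · simp [VariableChange.map, hr]
    · simp [VariableChange.map, hs]
    · simp [VariableChange.map, ht]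
  rw [← map_variableChange, hC, ← hE, hCE]

end CuspNormal

/-! ## §2 The minimal model of `W/ℚ` at an additive prime, over every valued field -/

section Main

variable (W : WeierstrassCurve ℚ) [W.IsElliptic] [W.IsGloballyMinimal] (p : ℕ) [hp : Fact p.Prime]
  {F : Type*} [Field F] (w : Valuation F ℝ≥0)

/-- **`|x(pP)|·|p|² = |x(P)|` and `pP ≠ O` on the kernel of reduction of the minimal model at an ADDITIVE
prime, over EVERY valued field.** For the globally minimal `W/ℚ` with `Addv W p`, a field `F` with a
valuation `|·|` in which `p ≠ 0`, and a point `P = (x, y)` of `W_ℤ ⊗ F` with `|x| > 1`: `pP ≠ O`, and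
`|x(pP)| · |p|² = |x|` — the points-level form of LEMMA A ("additive ⇒ the `ℚ_p`-minimal formal group is
`Ĝ_a`": `|z(pP)| = |p|·|z(P)|`), with NO completeness and NO restriction on the ramification of `F`.
Proof: transport along the integral isomorphism `(1, r, s, t)` to a cusp-normal integer model
(`exists_rst_map_eq_zero_of_addv`; `x ↦ x - r` preserves `|x| > 1`), where `p² ∣ ΨSq_p`
(`sq_dvd_coeff_ΨSq_of_map_eq_zero`) and the division-polynomial estimate applies.
[cite: SilvermanAEC2009, Exercise 3.7(d), Prop. III.2.5 and VII.5 Prop. 5.1 (c)] -/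
theorem val_x_zsmul_prime_of_addv (hadd : Addv W p) (hp0 : (p : F) ≠ 0) {x y : F}
    (hxy : ((integralModelInt W).map (Int.castRingHom F)).toAffine.Nonsingular x y) (hx : 1 < w x) :
    (p : ℤ) • (Affine.Point.some x y hxy) ≠ 0 ∧
      ∀ {x' y' : F} (h' : ((integralModelInt W).map (Int.castRingHom F)).toAffine.Nonsingular x' y'),
        (p : ℤ) • (Affine.Point.some x y hxy) = Affine.Point.some x' y' h' →
          1 < w x' ∧ w x' * w (p : F) ^ 2 = w x := by
  obtain ⟨r, s, t, hV'⟩ := exists_rst_map_eq_zero_of_addv W p hadd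
  have hΨ := sq_dvd_coeff_ΨSq_of_map_eq_zero _ p hV'
  obtain ⟨hΦF, hΨF⟩ := val_coeff_le_of_sq_dvd_coeff_ΨSq w p _ hΨ (F := F)
  -- the change of variables over `F`
  have hcurve : ((⟨1, r, s, t⟩ : VariableChange ℤ).map (Int.castRingHom F)) •
      ((integralModelInt W).map (Int.castRingHom F)) =
        (((⟨1, r, s, t⟩ : VariableChange ℤ) • integralModelInt W).map (Int.castRingHom F)) :=
    map_variableChange _ _ _
  rw [← hcurve] at hΦF hΨF
  have htoX : ∀ z : F, ((⟨1, r, s, t⟩ : VariableChange ℤ).map (Int.castRingHom F)).toX z = z - (r : F) := by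
    intro z
    rw [VariableChange.toX_def]
    simp [VariableChange.map]
  have hpw1 : w (p : F) ≤ 1 := FormalGroupChart.val_natCast_le_one w p
  have hrx : ∀ {z : F}, 1 < w z → w (z - (r : F)) = w z := fun {z} hz ↦
    Valuation.map_sub_eq_of_lt_left _ (lt_of_le_of_lt (val_intCast_le_one' w r) hz)
  have hns := (VariableChange.nonsingular_iff _
    ((⟨1, r, s, t⟩ : VariableChange ℤ).map (Int.castRingHom F)) x y).mpr hxy
  have hx1 : 1 < w (((⟨1, r, s, t⟩ : VariableChange ℤ).map (Int.castRingHom F)).toX x) := by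
    rw [htoX, hrx hx]; exact hx
  obtain ⟨hne, hval⟩ := val_x_zsmul_prime_of_val_coeff_le w _ p hp0 hΦF hΨF hns hx1
  have hmapP := VariableChange.pointEquiv_some ((integralModelInt W).map (Int.castRingHom F))
    ((⟨1, r, s, t⟩ : VariableChange ℤ).map (Int.castRingHom F)) hxy
  refine ⟨fun h0 ↦ hne ?_, fun {x' y'} h' he ↦ ?_⟩
  · have := congrArg (VariableChange.pointEquiv ((integralModelInt W).map (Int.castRingHom F))
      ((⟨1, r, s, t⟩ : VariableChange ℤ).map (Int.castRingHom F))) h0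
    rwa [map_zsmul, map_zero, hmapP] at this
  · have he' := congrArg (VariableChange.pointEquiv ((integralModelInt W).map (Int.castRingHom F))
      ((⟨1, r, s, t⟩ : VariableChange ℤ).map (Int.castRingHom F))) he
    rw [map_zsmul, hmapP, VariableChange.pointEquiv_some] at he'
    have hv := hval _ he'
    rw [htoX, htoX, hrx hx] at hv
    -- `|x' - r| · |p|² = |x| > 1` forces `|x' - r| > 1`, hence `|x'| = |x' - r|`
    have h1 : 1 < w (x' - (r : F)) := by
      by_contra hle
      rw [not_lt] at hle
      have : w (x' - (r : F)) * w (p : F) ^ 2 ≤ 1 := mul_le_one' hle (pow_le_one₀ (by positivity) hpw1)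
      rw [hv] at this
      exact absurd hx (not_lt.mpr this)
    have hx' : w x' = w (x' - (r : F)) := by
      have := Valuation.map_add_eq_of_lt_left w (x := x' - (r : F)) (y := (r : F))
        (lt_of_le_of_lt (val_intCast_le_one' w r) h1)
      rwa [sub_add_cancel] at this
    rw [hx']
    exact ⟨h1, hv⟩

/-- **The kernel of reduction of the minimal model at an additive prime is TORSION-FREE over every valued
field** (`p ≠ 0`, `|p| < 1` in `F`): for `P = (x, y)` on `W_ℤ ⊗ F` with `|x| > 1` and `n ≠ 0`, `nP ≠ O`.
(`p`-power part by `val_x_zsmul_prime_of_addv`, iterated; prime-to-`p` part by the tree's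
`val_le_one_of_zsmul_eq_zero` — an integer prime to `p` is a `|·|`-unit since `|p| < 1`.) This is the
memo's corollary (b) "`W₁^ℚ(K)` is torsion-free" for EVERY extension `K`, however ramified, with no
completeness hypothesis. [cite: SilvermanAEC2009, VII.3.1 and Exercise 3.7(d)] -/
theorem zsmul_ne_zero_of_addv_of_one_lt_val (hadd : Addv W p) (hp0 : (p : F) ≠ 0) (hp1 : w (p : F) < 1)
    {n : ℤ} (hn : n ≠ 0) {x y : F}
    (hxy : ((integralModelInt W).map (Int.castRingHom F)).toAffine.Nonsingular x y) (hx : 1 < w x) :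
    n • (Affine.Point.some x y hxy) ≠ 0 := by
  haveI hint : ((integralModelInt W).map (Int.castRingHom F)).IsIntegral w.integer :=
    isIntegral_integer_of_val_le_one (by rw [map_a₁, eq_intCast]; exact val_intCast_le_one' w _)
      (by rw [map_a₂, eq_intCast]; exact val_intCast_le_one' w _)
      (by rw [map_a₃, eq_intCast]; exact val_intCast_le_one' w _)
      (by rw [map_a₄, eq_intCast]; exact val_intCast_le_one' w _)
      (by rw [map_a₆, eq_intCast]; exact val_intCast_le_one' w _)
  -- induction on `|n|`, peeling off factors of `p`
  induction hN : n.natAbs using Nat.strong_induction_on generalizing n x y with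
  | _ N ih =>
    subst hN
    by_cases hpn : (p : ℤ) ∣ n
    · obtain ⟨n₁, rfl⟩ := hpn
      have hn₁ : n₁ ≠ 0 := fun h ↦ hn (by rw [h, mul_zero])
      obtain ⟨hne, hval⟩ := val_x_zsmul_prime_of_addv W p w hadd hp0 hxy hx
      intro h0
      rw [mul_comm, mul_zsmul] at h0
      -- `pP` is again an affine point of the kernel
      rcases hP : (p : ℤ) • (Affine.Point.some x y hxy) with _ | ⟨x₁, y₁, h₁⟩
      · exact hne hP
      · obtain ⟨hx₁, -⟩ := hval h₁ hP
        rw [hP] at h0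
        refine ih n₁.natAbs ?_ hn₁ h₁ hx₁ rfl h0
        rw [Int.natAbs_mul, Int.natAbs_natCast]
        exact lt_mul_of_one_lt_left (Int.natAbs_pos.mpr hn₁) hp.out.one_lt
    · intro h0
      have hw : w (n : F) = 1 := val_intCast_eq_one_of_not_dvd w hp1 hpn
      exact absurd (val_le_one_of_zsmul_eq_zero hw h0) (not_le.mpr hx)

/-- **`|z(pP)| = |p| · |z(P)|` on the kernel of reduction `E₁(F)` of the minimal model at an additive prime**
(chart currency of `FormalGroupChart`: `z = -x/y`, `|x|·|z|² = 1`), every valued field with `p ≠ 0`: the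
local parameter is multiplied by EXACTLY `|p|` under `[p]` at every level — the formal group is `Ĝ_a`
"on the nose", not only below the level `|p|`. [cite: SilvermanAEC2009, Prop. VII.2.2 and Exercise 3.7(d)] -/
theorem val_zCoord_zsmul_prime_of_addv (hadd : Addv W p) (hp0 : (p : F) ≠ 0)
    [hint : ((integralModelInt W).map (Int.castRingHom F)).IsIntegral w.integer]
    {P : ((integralModelInt W).map (Int.castRingHom F)).toAffine.Point}
    (hP : P ∈ FormalGroupChart.kernel w ((integralModelInt W).map (Int.castRingHom F))) :
    w ((p : ℤ) • P).zCoord = w (p : F) * w P.zCoord := by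
  rcases P with _ | ⟨x, y, hxy⟩
  · rw [← WeierstrassCurve.Affine.Point.zero_def, zsmul_zero, WeierstrassCurve.Affine.Point.zCoord_zero,
      map_zero, mul_zero]
  · have hx : 1 < w x := hP rfl
    obtain ⟨hne, hval⟩ := val_x_zsmul_prime_of_addv W p w hadd hp0 hxy hx
    rcases hQ : (p : ℤ) • (Affine.Point.some x y hxy) with _ | ⟨x₁, y₁, h₁⟩
    · exact absurd hQ hne
    · obtain ⟨hx₁, hv⟩ := hval h₁ hQ
      have hmem₁ : (Affine.Point.some x₁ y₁ h₁ : _) ∈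
          FormalGroupChart.kernel w ((integralModelInt W).map (Int.castRingHom F)) :=
        FormalGroupChart.some_mem_kernel h₁ hx₁
      obtain ⟨hz, -, -⟩ := FormalGroupChart.val_X_mul_val_zCoord_sq hP
      obtain ⟨hz₁, -, -⟩ := FormalGroupChart.val_X_mul_val_zCoord_sq hmem₁
      rw [WeierstrassCurve.Affine.Point.zCoord_some, WeierstrassCurve.Affine.Point.zCoord_some]
      -- `|x|·|z|² = 1 = |x₁|·|z₁|²` and `|x₁|·|p|² = |x|` give `|z₁|² = (|p|·|z|)²`
      have hx₁0 : w x₁ ≠ 0 := (zero_lt_one.trans hx₁).ne'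
      have hsq : w (-x₁ / y₁) ^ 2 = (w (p : F) * w (-x / y)) ^ 2 := by
        refine mul_left_cancel₀ hx₁0 ?_
        rw [hz₁, mul_pow, ← mul_assoc, hv, hz]
      exact (pow_left_inj₀ (by positivity) (by positivity) two_ne_zero).mp hsq

end Main

end Summit.BirchSwinnertonDyer.Rank1Residual.Additive
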